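import Mathlib
import HarnessLib
import Literature.MathematicalPhysics.PowerSystems.StrictSectorBound

/-!
# Quadratic Lyapunov functions for sector-bounded Lur'e systems — the local circle criterion of
# Vu–Turitsyn (IEEE TAC 2017, Lemma 1 and Lemma 2, Appendix A)

Topic `Literature/MathematicalPhysics/PowerSystems`, namespace
`Literature.MathematicalPhysics.PowerSystems.QuadraticCertificate`.
Everything below is PROVED from Mathlib (no named facts, no definitions, no new axioms).

Source (held, read this session on the page): T. L. Vu, K. Turitsyn, *A framework for robust
assessment of power grid stability and resiliency*, IEEE Trans. Automat. Control 62 (2017)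
[VuTuritsyn2017] = arXiv:1504.04684 (`lit read arxiv:1504.04684`: §III bilinear form chunk
p0008; §IV-A/IV-B Lemma 1, Lemma 2 chunk p0009–p0010; Appendix 7.1 proof of Lemma 1 chunk p0016).

> [VuTuritsyn2017 §III] the structure-preserving model is written in the Lur'e / «bilinear»
> form «ẋ = A x − B F(C x)», F the vector of nonlinear couplings sin δ_kj − sin δ*_kj.
> [§IV-B, Lemma 1] «Consider the general system in the form (bilinear) in which the nonlinear
> vector F satisfies the sector bound condition that (F − K₁Cx)ᵀ(F − K₂Cx) ≤ 0 for some
> matrices K₁, K₂ and x belonging to the set S. Assume that there exists a positive definite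
> matrix P such that  AᵀP + PA − CᵀK₁ᵀK₂C + RᵀR ≤ 0,  where R = BᵀP − ½(K₁+K₂)C. Then, the
> quadratic Lyapunov function V(x(t)) = x(t)ᵀPx(t) is decreasing along trajectory of the
> system whenever x(t) is in the set S.» — «an extension of the classical circle criterion to
> the case when the sector bound condition only holds in a finite region».
> [Appendix 7.1] «V̇(x) = ẋᵀPx + xᵀPẋ = xᵀ(AᵀP+PA)x − 2xᵀPBF. Let W(x) = (F−K₁Cx)ᵀ(F−K₂Cx)
> … V̇(x) − W(x) = xᵀ[AᵀP + PA − CᵀK₁ᵀK₂C + RᵀR]x − SᵀS, where R = BᵀP − ½(K₁+K₂)C and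
> S = F + (BᵀP − ½(K₁+K₂)C)x. … Therefore V̇(x) = W(x) − xᵀQx − SᵀS ≤ 0, ∀ x ∈ S.»
> [§IV-B, Lemma 2] for the power-grid nonlinearity with K₁ = gI, K₂ = I the condition reads
> «(A − ½(1+g)BC)ᵀP + P(A − ½(1+g)BC) + PBBᵀP + ((1−g)²/4) CᵀC ≤ 0» (or its Schur-complement
> LMI form); Proof: «the vector of nonlinear interactions F satisfies the sector bound condition
> (F − K₁Cx)ᵀ(F − K₂Cx) ≤ 0 in which K₁ = gI, K₂ = I and the set S is the polytope P defined by
> |δ_kj| ≤ π/2. Applying Lemma 1 …».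
> [§IV-A] «g(δ_kj − δ*_kj)² ≤ (δ_kj − δ*_kj)(sin δ_kj − sin δ*_kj) ≤ (δ_kj − δ*_kj)²» on |δ_kj| ≤ π/2,
> hence «(F(Cx) − gCx)ᵀ(F(Cx) − Cx) ≤ 0, ∀ x ∈ P».

## Rendering

* Index types `ι` (states) and `κ` (nonlinear channels / edges), real matrices
  `A P : Matrix ι ι ℝ`, `B : Matrix ι κ ℝ`, `C : Matrix κ ι ℝ`, `K₁ K₂ : Matrix κ κ ℝ`;
  `R` and the LMI matrix `M := AᵀP + PA − CᵀK₁ᵀK₂C + RᵀR` are passed as arguments pinned by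
  defining equations `hR`, `hM` (so users may supply them in any syntactic form).
* `decay_identity` is the printed Appendix-7.1 identity, pointwise in the state `x` and the
  nonlinearity value `F` (only `Pᵀ = P` is used). `decay_of_sector_of_lmi` is Lemma 1 pointwise:
  sector inequality at `(x, F)` and `xᵀMx ≤ 0` give `xᵀ(AᵀP+PA)x − 2xᵀPBF ≤ −‖F + Rx‖² ≤ 0`;
  `decay_of_sector_of_negSemidef` takes the LMI as `(−M).PosSemidef` (Mathlib), which is
  exactly what the tree's exact-rational PSD checkers (`Literature/Computation/Certificates/
  PosSemidefDecide`, `PSD.LDLCert.posSemidef`) deliver for a rounded numerical `P`.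
  Positivity of `P` (needed for `V` to be a Lyapunov CANDIDATE) plays no role in the decay
  statement and is therefore not assumed — the typed statements are the printed ones with that
  hypothesis dropped.
* `quadraticForm_hasDerivAt` + `lyapunov_hasDerivAt` give the trajectory form: along a solution
  of `ẋ = Ax − BF` (componentwise `HasDerivAt` at the instant `t`, `F` the coupling value at
  `t`), `V = xᵀPx` has derivative `xᵀ(AᵀP+PA)x − 2xᵀPBF`, hence `≤ 0` under Lemma 1's
  hypotheses (`lyapunov_deriv_nonpos` — «V is decreasing whenever x(t) ∈ S»).
* `lmi_quadForm_eq_lemma2Form` is the algebra behind Lemma 2: with `K₁ = g•1`, `K₂ = 1` the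
  quadratic form of `M` equals that of `(A − ½(1+g)BC)ᵀP + P(A − ½(1+g)BC) + PBBᵀP +
  ((1−g)²/4)CᵀC`; `sector_of_componentwise` + the tree lemma
  `SinusoidalCoupling.lurieSector_nonpos` (file `StrictSectorBound`) give the vector sector
  condition for the sinusoidal couplings on the polytope |δ_kj| ≤ π/2 (`sinusoidal_sector`).
* MODELLED: the Lur'e form covers the lossless structure-preserving / classical models with the
  couplings separated as in [VuTuritsyn2017 §III]; CERTIFIED use = exact PSD certificate of a
  rational `−M` + these lemmas; the invariance / convergence conclusions (Theorem 1 of the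
  source: sublevel set below `V_min` inside the polytope) are NOT typed here.
-/

namespace Literature.MathematicalPhysics.PowerSystems.QuadraticCertificate

open Matrix

variable {ι κ : Type*} [Fintype ι] [Fintype κ]

/-- `xᵀ(Nᵀy) = (Nx)ᵀy` (private helper). [folklore] -/
private theorem dot_transpose_mulVec (N : Matrix κ ι ℝ) (x : ι → ℝ) (y : κ → ℝ) :
    x ⬝ᵥ (Nᵀ *ᵥ y) = (N *ᵥ x) ⬝ᵥ y := by
  rw [dotProduct_mulVec, vecMul_transpose]

/-- `xᵀ(Ny) = (Nᵀx)ᵀy` (private helper). [folklore] -/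
private theorem dot_mulVec_eq_transpose (N : Matrix ι κ ℝ) (x : ι → ℝ) (y : κ → ℝ) :
    x ⬝ᵥ (N *ᵥ y) = (Nᵀ *ᵥ x) ⬝ᵥ y := by
  rw [dotProduct_mulVec, ← mulVec_transpose]

/-- **The decay identity of Vu–Turitsyn's Lemma 1** (Appendix 7.1, as printed:
«V̇(x) − W(x) = xᵀ[AᵀP + PA − CᵀK₁ᵀK₂C + RᵀR]x − SᵀS», `V̇ = xᵀ(AᵀP+PA)x − 2xᵀPBF`,
`W = (F−K₁Cx)ᵀ(F−K₂Cx)`, `R = BᵀP − ½(K₁+K₂)C`, `S = F + Rx`), for a symmetric `P`, pointwise in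
the state `x` and the nonlinearity value `F`. [cite: VuTuritsyn2017, Appendix A (proof of Lemma 1)] -/
theorem decay_identity (A P : Matrix ι ι ℝ) (B : Matrix ι κ ℝ) (C : Matrix κ ι ℝ)
    (K₁ K₂ : Matrix κ κ ℝ) (R : Matrix κ ι ℝ) (M : Matrix ι ι ℝ) (hP : Pᵀ = P)
    (hR : R = Bᵀ * P - (1 / 2 : ℝ) • ((K₁ + K₂) * C))
    (hM : M = Aᵀ * P + P * A - Cᵀ * K₁ᵀ * K₂ * C + Rᵀ * R) (x : ι → ℝ) (F : κ → ℝ) :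
    x ⬝ᵥ ((Aᵀ * P + P * A) *ᵥ x) - 2 * (x ⬝ᵥ (P *ᵥ (B *ᵥ F)))
      = (F - K₁ *ᵥ (C *ᵥ x)) ⬝ᵥ (F - K₂ *ᵥ (C *ᵥ x)) + x ⬝ᵥ (M *ᵥ x)
        - (F + R *ᵥ x) ⬝ᵥ (F + R *ᵥ x) := by
  -- the atoms: u = Px, Ax, p = K₁Cx, q = K₂Cx, b = BᵀPx, r = Rx
  have hAP : x ⬝ᵥ ((Aᵀ * P + P * A) *ᵥ x) = 2 * ((A *ᵥ x) ⬝ᵥ (P *ᵥ x)) := by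
    rw [add_mulVec, ← mulVec_mulVec, ← mulVec_mulVec, dotProduct_add, dot_transpose_mulVec,
      dot_mulVec_eq_transpose P x (A *ᵥ x), hP, dotProduct_comm (P *ᵥ x) (A *ᵥ x)]
    ring
  have hPB : x ⬝ᵥ (P *ᵥ (B *ᵥ F)) = (Bᵀ *ᵥ (P *ᵥ x)) ⬝ᵥ F := by
    rw [dot_mulVec_eq_transpose P, hP, dot_mulVec_eq_transpose B]
  have hCK : x ⬝ᵥ ((Cᵀ * K₁ᵀ * K₂ * C) *ᵥ x) = (K₁ *ᵥ (C *ᵥ x)) ⬝ᵥ (K₂ *ᵥ (C *ᵥ x)) := by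
    rw [← mulVec_mulVec, ← mulVec_mulVec, ← mulVec_mulVec, dot_transpose_mulVec,
      dot_transpose_mulVec]
  have hRx : R *ᵥ x = Bᵀ *ᵥ (P *ᵥ x) - (1 / 2 : ℝ) • (K₁ *ᵥ (C *ᵥ x) + K₂ *ᵥ (C *ᵥ x)) := by
    rw [hR, sub_mulVec, smul_mulVec, ← mulVec_mulVec, ← mulVec_mulVec, add_mulVec]
  have hRR : x ⬝ᵥ ((Rᵀ * R) *ᵥ x) = (R *ᵥ x) ⬝ᵥ (R *ᵥ x) := by
    rw [← mulVec_mulVec, dot_transpose_mulVec]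
  have hMx : x ⬝ᵥ (M *ᵥ x) = 2 * ((A *ᵥ x) ⬝ᵥ (P *ᵥ x))
      - (K₁ *ᵥ (C *ᵥ x)) ⬝ᵥ (K₂ *ᵥ (C *ᵥ x)) + (R *ᵥ x) ⬝ᵥ (R *ᵥ x) := by
    rw [hM, add_mulVec, sub_mulVec, dotProduct_add, dotProduct_sub, hAP, hCK, hRR]
  have hFr : F ⬝ᵥ (R *ᵥ x) = (Bᵀ *ᵥ (P *ᵥ x)) ⬝ᵥ F
      - 1 / 2 * ((K₁ *ᵥ (C *ᵥ x)) ⬝ᵥ F + (K₂ *ᵥ (C *ᵥ x)) ⬝ᵥ F) := by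
    rw [hRx, dotProduct_sub, dotProduct_smul, dotProduct_add, smul_eq_mul,
      dotProduct_comm F (Bᵀ *ᵥ (P *ᵥ x)), dotProduct_comm F (K₁ *ᵥ (C *ᵥ x)),
      dotProduct_comm F (K₂ *ᵥ (C *ᵥ x))]
  have hSS : (F + R *ᵥ x) ⬝ᵥ (F + R *ᵥ x)
      = F ⬝ᵥ F + 2 * (F ⬝ᵥ (R *ᵥ x)) + (R *ᵥ x) ⬝ᵥ (R *ᵥ x) := by
    rw [add_dotProduct, dotProduct_add, dotProduct_add, dotProduct_comm (R *ᵥ x) F]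
    ring
  have hW : (F - K₁ *ᵥ (C *ᵥ x)) ⬝ᵥ (F - K₂ *ᵥ (C *ᵥ x))
      = F ⬝ᵥ F - (K₂ *ᵥ (C *ᵥ x)) ⬝ᵥ F - (K₁ *ᵥ (C *ᵥ x)) ⬝ᵥ F
        + (K₁ *ᵥ (C *ᵥ x)) ⬝ᵥ (K₂ *ᵥ (C *ᵥ x)) := by
    rw [sub_dotProduct, dotProduct_sub, dotProduct_sub, dotProduct_comm F (K₂ *ᵥ (C *ᵥ x))]
    ring
  rw [hAP, hPB, hMx, hSS, hFr, hW]
  ring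

/-- **Lemma 1 of Vu–Turitsyn 2017, pointwise form** («extension of the classical circle criterion
to the case when the sector bound condition only holds in a finite region»): if at the state `x`
the nonlinearity value `F` satisfies the sector condition `(F − K₁Cx)ᵀ(F − K₂Cx) ≤ 0` and the LMI
matrix `M = AᵀP + PA − CᵀK₁ᵀK₂C + RᵀR` (with `R = BᵀP − ½(K₁+K₂)C`, `P` symmetric) satisfies
`xᵀMx ≤ 0`, then the derivative expression of `V = xᵀPx` along `ẋ = Ax − BF` obeys
`xᵀ(AᵀP+PA)x − 2xᵀPBF ≤ −‖F + Rx‖²` (in particular `≤ 0`). The printed hypothesis «P positive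
definite» is not needed for this conclusion and is not assumed.
[cite: VuTuritsyn2017, §IV-B Lemma 1 + Appendix A] -/
theorem decay_of_sector_of_lmi (A P : Matrix ι ι ℝ) (B : Matrix ι κ ℝ) (C : Matrix κ ι ℝ)
    (K₁ K₂ : Matrix κ κ ℝ) (R : Matrix κ ι ℝ) (M : Matrix ι ι ℝ) (hP : Pᵀ = P)
    (hR : R = Bᵀ * P - (1 / 2 : ℝ) • ((K₁ + K₂) * C))
    (hM : M = Aᵀ * P + P * A - Cᵀ * K₁ᵀ * K₂ * C + Rᵀ * R) (x : ι → ℝ) (F : κ → ℝ)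
    (hsector : (F - K₁ *ᵥ (C *ᵥ x)) ⬝ᵥ (F - K₂ *ᵥ (C *ᵥ x)) ≤ 0) (hlmi : x ⬝ᵥ (M *ᵥ x) ≤ 0) :
    x ⬝ᵥ ((Aᵀ * P + P * A) *ᵥ x) - 2 * (x ⬝ᵥ (P *ᵥ (B *ᵥ F)))
      ≤ -((F + R *ᵥ x) ⬝ᵥ (F + R *ᵥ x)) := by
  rw [decay_identity A P B C K₁ K₂ R M hP hR hM x F]
  linarith

/-- **Lemma 1, sign form**: under the hypotheses of `decay_of_sector_of_lmi`,
`xᵀ(AᵀP+PA)x − 2xᵀPBF ≤ 0` («V … is decreasing … whenever x(t) is in the set S»).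
[cite: VuTuritsyn2017, §IV-B Lemma 1] -/
theorem decay_nonpos_of_sector_of_lmi (A P : Matrix ι ι ℝ) (B : Matrix ι κ ℝ) (C : Matrix κ ι ℝ)
    (K₁ K₂ : Matrix κ κ ℝ) (R : Matrix κ ι ℝ) (M : Matrix ι ι ℝ) (hP : Pᵀ = P)
    (hR : R = Bᵀ * P - (1 / 2 : ℝ) • ((K₁ + K₂) * C))
    (hM : M = Aᵀ * P + P * A - Cᵀ * K₁ᵀ * K₂ * C + Rᵀ * R) (x : ι → ℝ) (F : κ → ℝ)
    (hsector : (F - K₁ *ᵥ (C *ᵥ x)) ⬝ᵥ (F - K₂ *ᵥ (C *ᵥ x)) ≤ 0) (hlmi : x ⬝ᵥ (M *ᵥ x) ≤ 0) :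
    x ⬝ᵥ ((Aᵀ * P + P * A) *ᵥ x) - 2 * (x ⬝ᵥ (P *ᵥ (B *ᵥ F))) ≤ 0 := by
  have h := decay_of_sector_of_lmi A P B C K₁ K₂ R M hP hR hM x F hsector hlmi
  have hS : 0 ≤ (F + R *ᵥ x) ⬝ᵥ (F + R *ᵥ x) := by
    simpa using dotProduct_star_self_nonneg (F + R *ᵥ x)
  linarith

/-- **Lemma 1 with the LMI as a semidefiniteness certificate**: if `−M` is positive semidefinite
(`Matrix.PosSemidef`, e.g. discharged for a rational `M` by the tree's exact LDLᵀ checker) then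
`xᵀMx ≤ 0` for every state, so the sector condition at `(x, F)` alone gives the decay
inequality `xᵀ(AᵀP+PA)x − 2xᵀPBF ≤ −‖F + Rx‖² ≤ 0`. [cite: VuTuritsyn2017, §IV-B Lemma 1
(«AᵀP + PA − CᵀK₁ᵀK₂C + RᵀR ≤ 0»)] -/
theorem decay_of_sector_of_negSemidef (A P : Matrix ι ι ℝ) (B : Matrix ι κ ℝ) (C : Matrix κ ι ℝ)
    (K₁ K₂ : Matrix κ κ ℝ) (R : Matrix κ ι ℝ) (M : Matrix ι ι ℝ) (hP : Pᵀ = P)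
    (hR : R = Bᵀ * P - (1 / 2 : ℝ) • ((K₁ + K₂) * C))
    (hM : M = Aᵀ * P + P * A - Cᵀ * K₁ᵀ * K₂ * C + Rᵀ * R) (hneg : (-M).PosSemidef)
    (x : ι → ℝ) (F : κ → ℝ)
    (hsector : (F - K₁ *ᵥ (C *ᵥ x)) ⬝ᵥ (F - K₂ *ᵥ (C *ᵥ x)) ≤ 0) :
    x ⬝ᵥ ((Aᵀ * P + P * A) *ᵥ x) - 2 * (x ⬝ᵥ (P *ᵥ (B *ᵥ F)))
      ≤ -((F + R *ᵥ x) ⬝ᵥ (F + R *ᵥ x)) := by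
  have h0 : 0 ≤ star x ⬝ᵥ ((-M) *ᵥ x) := hneg.dotProduct_mulVec_nonneg x
  have hlmi : x ⬝ᵥ (M *ᵥ x) ≤ 0 := by
    rw [star_trivial, neg_mulVec, dotProduct_neg] at h0
    linarith
  exact decay_of_sector_of_lmi A P B C K₁ K₂ R M hP hR hM x F hsector hlmi

/-- **Derivative of a quadratic form along a curve** (the first display of Appendix 7.1,
«V̇(x) = ẋᵀPx + xᵀPẋ»): for symmetric `P` and component functions `x i : ℝ → ℝ` with
derivatives `x' i` at `t`, `V(s) = x(s)ᵀ P x(s)` has derivative `2·x(t)ᵀ P x'` at `t`.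
[cite: VuTuritsyn2017, Appendix A (first display)] -/
theorem quadraticForm_hasDerivAt (P : Matrix ι ι ℝ) (hP : Pᵀ = P) (x : ι → ℝ → ℝ)
    (x' : ι → ℝ) (t : ℝ) (hx : ∀ i, HasDerivAt (x i) (x' i) t) :
    HasDerivAt (fun s => (fun i => x i s) ⬝ᵥ (P *ᵥ fun i => x i s))
      (2 * ((fun i => x i t) ⬝ᵥ (P *ᵥ x'))) t := by
  have hPij : ∀ i j, P j i = P i j := fun i j => by
    have := congrFun (congrFun hP i) j
    simpa [transpose_apply] using this
  -- V as a double sum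
  have hV : (fun s => (fun i => x i s) ⬝ᵥ (P *ᵥ fun i => x i s))
      = fun s => ∑ i, ∑ j, x i s * (P i j * x j s) := by
    funext s
    simp only [dotProduct, mulVec, Finset.mul_sum]
  rw [hV]
  have hd : HasDerivAt (fun s => ∑ i, ∑ j, x i s * (P i j * x j s))
      (∑ i, ∑ j, (x' i * (P i j * x j t) + x i t * (P i j * x' j))) t := by
    apply HasDerivAt.fun_sum
    intro i _
    apply HasDerivAt.fun_sum
    intro j _
    exact (hx i).mul ((hx j).const_mul (P i j))
  refine hd.congr_deriv ?_
  -- symmetrise: Σ_i Σ_j x'_i P_ij x_j = Σ_i Σ_j x_i P_ij x'_j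
  have hswap : ∑ i, ∑ j, x' i * (P i j * x j t) = ∑ i, ∑ j, x i t * (P i j * x' j) := by
    rw [Finset.sum_comm]
    refine Finset.sum_congr rfl fun i _ => Finset.sum_congr rfl fun j _ => ?_
    rw [hPij i j]
    ring
  have hdot : (fun i => x i t) ⬝ᵥ (P *ᵥ x') = ∑ i, ∑ j, x i t * (P i j * x' j) := by
    simp only [dotProduct, mulVec, Finset.mul_sum]
  rw [Finset.sum_congr rfl fun i _ => Finset.sum_add_distrib, Finset.sum_add_distrib, hswap,
    hdot]
  ring

/-- **`V̇` along the Lur'e system** (Appendix 7.1: «V̇(x) = xᵀ(AᵀP+PA)x − 2xᵀPBF»): if the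
component functions solve `ẋ = A x − B F` at the instant `t` (`F` = value of the nonlinearity at
`t`) and `P` is symmetric, then `V = xᵀPx` has derivative `x(t)ᵀ(AᵀP+PA)x(t) − 2x(t)ᵀPBF` at `t`.
[cite: VuTuritsyn2017, Appendix A] -/
theorem lyapunov_hasDerivAt (A P : Matrix ι ι ℝ) (B : Matrix ι κ ℝ) (hP : Pᵀ = P)
    (x : ι → ℝ → ℝ) (x' : ι → ℝ) (F : κ → ℝ) (t : ℝ) (hx : ∀ i, HasDerivAt (x i) (x' i) t)
    (hode : x' = A *ᵥ (fun i => x i t) - B *ᵥ F) :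
    HasDerivAt (fun s => (fun i => x i s) ⬝ᵥ (P *ᵥ fun i => x i s))
      ((fun i => x i t) ⬝ᵥ ((Aᵀ * P + P * A) *ᵥ fun i => x i t)
        - 2 * ((fun i => x i t) ⬝ᵥ (P *ᵥ (B *ᵥ F)))) t := by
  have h := quadraticForm_hasDerivAt P hP x x' t hx
  refine h.congr_deriv ?_
  rw [hode, mulVec_sub, dotProduct_sub, add_mulVec, ← mulVec_mulVec, ← mulVec_mulVec,
    dotProduct_add, dot_transpose_mulVec,
    dot_mulVec_eq_transpose P (fun i => x i t) (A *ᵥ fun i => x i t), hP,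
    dotProduct_comm (P *ᵥ fun i => x i t) (A *ᵥ fun i => x i t)]
  ring

/-- **Lemma 1 of Vu–Turitsyn 2017, trajectory form** («the quadratic Lyapunov function
V(x(t)) = x(t)ᵀPx(t) is decreasing along trajectory of the system whenever x(t) is in the set
S»): along a solution of `ẋ = Ax − BF(Cx)` at an instant where the sector condition holds, and
given the LMI `−M ⪰ 0`, the derivative of `V` is `≤ 0`. [cite: VuTuritsyn2017, §IV-B Lemma 1] -/
theorem lyapunov_deriv_nonpos (A P : Matrix ι ι ℝ) (B : Matrix ι κ ℝ) (C : Matrix κ ι ℝ)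
    (K₁ K₂ : Matrix κ κ ℝ) (R : Matrix κ ι ℝ) (M : Matrix ι ι ℝ) (hP : Pᵀ = P)
    (hR : R = Bᵀ * P - (1 / 2 : ℝ) • ((K₁ + K₂) * C))
    (hM : M = Aᵀ * P + P * A - Cᵀ * K₁ᵀ * K₂ * C + Rᵀ * R) (hneg : (-M).PosSemidef)
    (x : ι → ℝ → ℝ) (x' : ι → ℝ) (F : κ → ℝ) (t : ℝ) (hx : ∀ i, HasDerivAt (x i) (x' i) t)
    (hode : x' = A *ᵥ (fun i => x i t) - B *ᵥ F)
    (hsector : (F - K₁ *ᵥ (C *ᵥ fun i => x i t)) ⬝ᵥ (F - K₂ *ᵥ (C *ᵥ fun i => x i t)) ≤ 0) :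
    deriv (fun s => (fun i => x i s) ⬝ᵥ (P *ᵥ fun i => x i s)) t ≤ 0 := by
  rw [(lyapunov_hasDerivAt A P B hP x x' F t hx hode).deriv]
  have h := decay_of_sector_of_negSemidef A P B C K₁ K₂ R M hP hR hM hneg (fun i => x i t) F
    hsector
  have hS : 0 ≤ (F + R *ᵥ fun i => x i t) ⬝ᵥ (F + R *ᵥ fun i => x i t) := by
    simpa using dotProduct_star_self_nonneg (F + R *ᵥ fun i => x i t)
  linarith

/-- **The algebra of Lemma 2** (Vu–Turitsyn 2017 §IV-B): with `K₁ = g·I`, `K₂ = I` the LMI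
matrix of Lemma 1, `M = AᵀP + PA − g CᵀC + RᵀR`, `R = BᵀP − ½(1+g)C`, has the same quadratic
form as the printed Lemma-2 matrix `(A − ½(1+g)BC)ᵀP + P(A − ½(1+g)BC) + PBBᵀP + ((1−g)²/4)CᵀC`
(so a semidefiniteness certificate for either serves Lemma 1). [cite: VuTuritsyn2017, §IV-B
Lemma 2 (first display) and its proof] -/
theorem lmi_quadForm_eq_lemma2Form [DecidableEq κ] (A P : Matrix ι ι ℝ) (B : Matrix ι κ ℝ)
    (C : Matrix κ ι ℝ) (g : ℝ) (R : Matrix κ ι ℝ) (M M₂ : Matrix ι ι ℝ) (hP : Pᵀ = P)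
    (hR : R = Bᵀ * P - (1 / 2 : ℝ) • ((g • (1 : Matrix κ κ ℝ) + 1) * C))
    (hM : M = Aᵀ * P + P * A - Cᵀ * (g • (1 : Matrix κ κ ℝ))ᵀ * (1 : Matrix κ κ ℝ) * C + Rᵀ * R)
    (hM₂ : M₂ = (A - ((1 + g) / 2) • (B * C))ᵀ * P + P * (A - ((1 + g) / 2) • (B * C))
      + P * B * Bᵀ * P + ((1 - g) ^ 2 / 4) • (Cᵀ * C)) (v : ι → ℝ) :
    v ⬝ᵥ (M *ᵥ v) = v ⬝ᵥ (M₂ *ᵥ v) := by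
  -- quadratic form of M via the atoms of `decay_identity` (F := 0 there is not needed; direct)
  have hAP : v ⬝ᵥ ((Aᵀ * P + P * A) *ᵥ v) = 2 * ((A *ᵥ v) ⬝ᵥ (P *ᵥ v)) := by
    rw [add_mulVec, ← mulVec_mulVec, ← mulVec_mulVec, dotProduct_add, dot_transpose_mulVec,
      dot_mulVec_eq_transpose P v (A *ᵥ v), hP, dotProduct_comm (P *ᵥ v) (A *ᵥ v)]
    ring
  have hK : (g • (1 : Matrix κ κ ℝ))ᵀ * (1 : Matrix κ κ ℝ) = g • (1 : Matrix κ κ ℝ) := by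
    rw [transpose_smul, transpose_one, Matrix.mul_one]
  have hCK : v ⬝ᵥ ((Cᵀ * (g • (1 : Matrix κ κ ℝ))ᵀ * (1 : Matrix κ κ ℝ) * C) *ᵥ v)
      = g * ((C *ᵥ v) ⬝ᵥ (C *ᵥ v)) := by
    rw [Matrix.mul_assoc Cᵀ, hK, ← mulVec_mulVec, ← mulVec_mulVec, smul_mulVec, one_mulVec,
      dot_transpose_mulVec, dotProduct_smul, smul_eq_mul]
  have hRv : R *ᵥ v = Bᵀ *ᵥ (P *ᵥ v) - (1 / 2 : ℝ) • (g • (C *ᵥ v) + C *ᵥ v) := by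
    rw [hR, sub_mulVec, smul_mulVec, ← mulVec_mulVec, ← mulVec_mulVec, add_mulVec, smul_mulVec,
      one_mulVec]
  have hRR : v ⬝ᵥ ((Rᵀ * R) *ᵥ v) = (R *ᵥ v) ⬝ᵥ (R *ᵥ v) := by
    rw [← mulVec_mulVec, dot_transpose_mulVec]
  have hMv : v ⬝ᵥ (M *ᵥ v) = 2 * ((A *ᵥ v) ⬝ᵥ (P *ᵥ v)) - g * ((C *ᵥ v) ⬝ᵥ (C *ᵥ v))
      + (R *ᵥ v) ⬝ᵥ (R *ᵥ v) := by
    rw [hM, add_mulVec, sub_mulVec, dotProduct_add, dotProduct_sub, hAP, hCK, hRR]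
  have hRR' : (R *ᵥ v) ⬝ᵥ (R *ᵥ v) = (Bᵀ *ᵥ (P *ᵥ v)) ⬝ᵥ (Bᵀ *ᵥ (P *ᵥ v))
      - (1 + g) * ((Bᵀ *ᵥ (P *ᵥ v)) ⬝ᵥ (C *ᵥ v)) + ((1 + g) / 2) ^ 2 * ((C *ᵥ v) ⬝ᵥ (C *ᵥ v)) := by
    rw [hRv]
    simp only [sub_dotProduct, dotProduct_sub, add_dotProduct, dotProduct_add, smul_dotProduct,
      dotProduct_smul, smul_eq_mul]
    rw [dotProduct_comm (C *ᵥ v) (Bᵀ *ᵥ (P *ᵥ v))]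
    ring
  -- quadratic form of M₂
  have hA2 : v ⬝ᵥ (((A - ((1 + g) / 2) • (B * C))ᵀ * P + P * (A - ((1 + g) / 2) • (B * C))) *ᵥ v)
      = 2 * ((A *ᵥ v) ⬝ᵥ (P *ᵥ v)) - (1 + g) * ((Bᵀ *ᵥ (P *ᵥ v)) ⬝ᵥ (C *ᵥ v)) := by
    rw [add_mulVec, ← mulVec_mulVec, ← mulVec_mulVec, dotProduct_add, dot_transpose_mulVec,
      dot_mulVec_eq_transpose P v, hP, dotProduct_comm (P *ᵥ v) ((A - ((1 + g) / 2) • (B * C)) *ᵥ v),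
      sub_mulVec, smul_mulVec, ← mulVec_mulVec, sub_dotProduct, smul_dotProduct, smul_eq_mul,
      dotProduct_comm (B *ᵥ (C *ᵥ v)) (P *ᵥ v), dot_mulVec_eq_transpose B (P *ᵥ v) (C *ᵥ v)]
    ring
  have hPBBP : v ⬝ᵥ ((P * B * Bᵀ * P) *ᵥ v) = (Bᵀ *ᵥ (P *ᵥ v)) ⬝ᵥ (Bᵀ *ᵥ (P *ᵥ v)) := by
    rw [← mulVec_mulVec, ← mulVec_mulVec, ← mulVec_mulVec, dot_mulVec_eq_transpose P v, hP,
      dot_mulVec_eq_transpose B (P *ᵥ v)]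
  have hCC : v ⬝ᵥ ((((1 - g) ^ 2 / 4) • (Cᵀ * C)) *ᵥ v) = ((1 - g) ^ 2 / 4) * ((C *ᵥ v) ⬝ᵥ (C *ᵥ v)) := by
    rw [smul_mulVec, ← mulVec_mulVec, dotProduct_smul, smul_eq_mul, dot_transpose_mulVec]
  have hM₂v : v ⬝ᵥ (M₂ *ᵥ v) = 2 * ((A *ᵥ v) ⬝ᵥ (P *ᵥ v))
      - (1 + g) * ((Bᵀ *ᵥ (P *ᵥ v)) ⬝ᵥ (C *ᵥ v))
      + (Bᵀ *ᵥ (P *ᵥ v)) ⬝ᵥ (Bᵀ *ᵥ (P *ᵥ v)) + ((1 - g) ^ 2 / 4) * ((C *ᵥ v) ⬝ᵥ (C *ᵥ v)) := by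
    rw [hM₂, add_mulVec, add_mulVec, dotProduct_add, dotProduct_add, hA2, hPBBP, hCC]
  rw [hMv, hRR', hM₂v]
  ring

/-- **Vector sector condition from componentwise sector bounds** (the step «hence
(F(Cx) − gCx)ᵀ(F(Cx) − Cx) ≤ 0, ∀ x ∈ P» of §IV-A): if every channel satisfies
`(F_k − g w_k)(F_k − w_k) ≤ 0` then `(F − g·w)ᵀ(F − w) ≤ 0` (here `w = Cx`).
[cite: VuTuritsyn2017, §IV-A (display after the g-bound)] -/
theorem sector_of_componentwise (F w : κ → ℝ) (g : ℝ)
    (h : ∀ k, (F k - g * w k) * (F k - w k) ≤ 0) :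
    (F - g • w) ⬝ᵥ (F - w) ≤ 0 := by
  unfold dotProduct
  refine Finset.sum_nonpos fun k _ => ?_
  simpa [Pi.sub_apply, Pi.smul_apply, smul_eq_mul] using h k

/-- **The sinusoidal couplings satisfy the (g, 1) sector condition on the polytope**
(§IV-A + Lemma 2's proof «F satisfies the sector bound condition (F − K₁Cx)ᵀ(F − K₂Cx) ≤ 0 in
which K₁ = gI, K₂ = I and the set S is the polytope P defined by |δ_kj| ≤ π/2»): for edge angle
differences `δ k` with `|δ k| ≤ π/2`, equilibrium values `|δs k| < π/2`, and any gain `g` below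
every per-edge gain `(1 − sin|δs k|)/(π/2 − |δs k|)`, the vector `F_k = sin δ_k − sin δs_k`,
`w_k = δ_k − δs_k` obeys `(F − g·w)ᵀ(F − w) ≤ 0` — by the tree's
`SinusoidalCoupling.lurieSector_nonpos`. [cite: VuTuritsyn2017, §IV-A and §IV-B (proof of
Lemma 2)] -/
theorem sinusoidal_sector (δ δs : κ → ℝ) (g : ℝ) (hδs : ∀ k, |δs k| < Real.pi / 2)
    (hδ : ∀ k, |δ k| ≤ Real.pi / 2)
    (hg : ∀ k, g ≤ (1 - Real.sin |δs k|) / (Real.pi / 2 - |δs k|)) :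
    ((fun k => Real.sin (δ k) - Real.sin (δs k)) - g • (fun k => δ k - δs k))
      ⬝ᵥ ((fun k => Real.sin (δ k) - Real.sin (δs k)) - (fun k => δ k - δs k)) ≤ 0 :=
  sector_of_componentwise _ _ g fun k =>
    SinusoidalCoupling.lurieSector_nonpos (hδs k) (hδ k) (hg k)

end Literature.MathematicalPhysics.PowerSystems.QuadraticCertificate
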